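import Summits.QuantumFields.BalabanUV.Beta.D1BFx.WardJetsSources
import Summits.QuantumFields.BalabanUV.Beta.D1BFx.WardJetsSourcesParity
import Summits.QuantumFields.BalabanUV.Beta.D1BFx.KCombineCovStripped

/-!
# `BalabanUV.Beta.D1BFx.WardJetsSourcesTorus` — road «BF-x» for binder row D1, slot (K), identity side: **«WARD-L WITH SOURCES»** PART 2 —
# THE ROAD's TORI: THE CONVENTION's gauge jet `Wₛ = (Ê_b)^·N̂` of (A1) `KCombineCovStripped.hessKer_transfer_road_cov_stripped` IS a single-row
# generator table with the TIP read-out `Nt = N̂ ∘ tip`, so the packed Noether jets [P1]∕[P2] over `𝕄₀ = kkt K̂ 𝒬̂`, `Ŵ₀ = [Ŵ₀; 0]` give, for every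
# fine torus bond, (A1)'s letters `aₛ aₜ aₛₜ` WITH THE SOURCES `Eₛ[j,a] = −K̂[j,s]·N̂[tip j,a]`,
# `Eₛₜ[j,a] = −(kₜ[j,s] + [j=t]K̂[t,s] + [j=s]K̂[s,t])·N̂[tip j,a]` and its letters `bₛ bₜ bₛₜ` VERBATIM; plus the torus form of the parity constraint

HONEST DEPENDENCY (cell records, verbatim): «continuum YM on T⁴ ⇐ BetaPertH ∧ nine spine estimates (0/9 proved); BetaPertH ⇐ (D1) ∧ (D4) ∧
CAP+tail; G-an2-4 gates asym, D1 and NE2/3/4.»  HONEST FRAMING (cell contract, verbatim): «discharging `BetaPertH` makes Bałaban's UV stability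
UNCONDITIONAL — a real constructive-QFT result; it is NOT the continuum limit and NOT the Clay problem.»  THIS MODULE DISCHARGES NOTHING of (K),
of D1 or of the wall: [folklore] finite matrix bookkeeping over PART 1∕1b (`WardJetsSources`, `WardJetsSourcesParity`) and the road's torus objects
`TorusCombKKT.Khat`∕`Qhat`, `TorusGaugeBasis.What0`, `TorusGaugeBasisMatrix.Nhat`∕`What0_eq_grad_Nhat`, `TorusCoframeJets.Djet`∕`tip`,
`TorusHodgeWeight.DhatS`, `TorusGaugeBasisKernel.What0_eq_DhatS_mul_Nhat`, `TorusGaugeBasisTranspose.Khat_transpose` BY NAME.  No `def`, no `def … : Prop`, nothing cited, 0 sorry.  The packed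
Noether jets [P1]∕[P2] (equivalently PART 1 §4's congruence letters (C1)(C2) = «(Sd)∕(Wd) periodised» through the (A2-M) dictionary) are
HYPOTHESES here — an2's Q2 ∕ the owner's; `K̂·D̂ₛ = 0` (d*d ∘ d = 0 on all fine functions) is a displayed hypothesis of §3.  0 binders discharged;
(A1) of record stands vacuously in `aₛ aₜ aₛₜ` until «(A1) v2 WITH SOURCES»; (K) NOT closed; NOT D1, NOT BetaPertH, NOT continuum, NOT Clay.

ABSOLUTE RULE (cell charter, verbatim): «No internally-minted statement may enter as a cited fact. Every hypothesis is either kernel-proved in this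
package or a verbatim quotation of a PUBLISHED theorem with page reference. The manuscript(s) under audit are NOT citable for their own disputed
steps — they are the thing under adjudication; programme-internal (2001/route/tribunal) claims are never citable.»

WHY (owner RULING ρ-g11-7 l.32217, option (β): «WARD-L OF RECORD := [P1]∕[P2] WITH SOURCES under THE CONVENTION (`Eₛ = −oslotₛ`,
`(Eₛ)[j,a] = −K̂[j,s]·N̂[tip j,a]`; `Eₛₜ[j,a] = −(kₜ[j,s] + [j=t]K̂[t,s] + [j=s]K̂[s,t])·N̂[tip j,a]`) … first refusal leaf-03»).  This is the torus
instance: ν = `I 3 (m+1) p` (fine torus bonds, sorted), μ = `J 3 p` (coarse bonds), ρ = `CombRows (toSite r) (m+1) p` (comb bonds = gauge parameters),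
`K₀ = K̂`, `Q₀ = 𝒬̂`, `W₀ = Ŵ₀`, THE CONVENTION's jets `x₁ (inl i) = (Ê_{e₁ i})^·N̂` (`Djet_submatrix_mul_Nhat_apply`: single-row, TIP weight).
CONTENT (all [folklore]; block side `m+1`, coarse period `p`, fine period `s = (m+1)·p`, in-block root `toSite r`):
* §1 `Djet_submatrix_mul_Nhat_apply` (THE CONVENTION is single-row), `conv_eq_x₁` (it IS PART 1's `x₁ (inl ((e₁)⁻¹ b))` at the tip weight).
* §2 **`wardSrc₁_torus`**: [P1] ⟹ for every torus bond `b`, with `Wb := (Djet s b).submatrix (e₁ (m+1) p) id * Nhat r (m+1) p` and `kb := K₁ (inl (e₁⁻¹ b))`: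
  `kb * What0 + Khat * Wb = −(of fun j a ↦ Khat j (e₁⁻¹ b) * Nhat (tip s (e₁ j)) a)` and `qb * What0 + Qhat * Wb = 0` ((A1)'s `aₛ` with source, `bₛ` verbatim);
  **`wardSrc₂_torus`**: [P2] ⟹ for every pair `b b′` (A1)'s `aₛₜ` with source `−((kₜ j iₛ + [j = iₜ]·Khat iₜ iₛ + [j = iₛ]·Khat iₛ iₜ)·Nhat (tip (e₁ j)) a)`
  (`Wₛₜ = [b = b′]•Wₛ` as (A1) pins it) and `bₛₜ` verbatim.
* §3 the torus parity constraint: `DhatS_apply_eq` (`D̂ₛ j z = [z = tip (e₁ j)] − [z = (e₁ j).1]`), `TorusGaugeBasisKernel.What0_eq_DhatS_mul_Nhat` BY NAME, and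
  **`hadamard_of_tip_antisymm_torus`**: an ANTISYMMETRIC `kb` satisfying §2's letter with source forces, given `Khat * DhatS = 0`,
  `Σ_j Khat j (e₁⁻¹ b)·What0 j a·What0 j a′ = 0` for all comb bonds `a a′` — Q-WL-2 on the road's objects; the midpoint read-out carries no such constraint
  (PART 1b `symPart_midpoint_eq_zero`, stated here as `symPart_midpoint_torus_eq_zero` for the midpoint weight `½(N̂(tip) + N̂(base))`).
NOT HERE (honest): «(A1) v2 WITH SOURCES» (PART 2d∕2e fed with these sources), the periodisation of (Sd)∕(Wd) and the (A2-M∕N) dictionary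
`hJM•`∕`hJN•` (an2 ∕ owner), the discharge of `Khat * DhatS = 0`, the value of the Hadamard word on the road's tori, colour.
Unit `b2b-balaban-beta-d1-formalise-leaf-03` (gen 14), D1 formalisation swarm LEAF PROVER 03; road owner `b2b-balaban-beta-d1-p2`.
-/

noncomputable section

namespace Summit.QuantumFields.BalabanUV.Beta.D1BFx.WardJetsSourcesTorus

open Matrix
open scoped BigOperators
open Literature.MathematicalPhysics.QuantumFieldTheory.Balaban1983to89
open Literature.MathematicalPhysics.QuantumFieldTheory.Balaban1983to89.Beta
open Literature.MathematicalPhysics.QuantumFieldTheory.Balaban1983to89.Beta.Composition (kkt)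
open AffineAveraging (box toSite)
open Summit.QuantumFields.BalabanUV.Beta.D1BFx.SortedEmbedding (e₁)
open Summit.QuantumFields.BalabanUV.Beta.D1BFx.TorusCombKKT (I J CombRows Khat Qhat)
open Summit.QuantumFields.BalabanUV.Beta.D1BFx.TorusGaugeBasis (What0 Khat_mul_What0)
open Summit.QuantumFields.BalabanUV.Beta.D1BFx.TorusGaugeBasisMatrix (Nhat)
open Summit.QuantumFields.BalabanUV.Beta.D1BFx.TorusGaugeBasisKernel (What0_eq_DhatS_mul_Nhat)
open Summit.QuantumFields.BalabanUV.Beta.D1BFx.TorusGaugeBasisTranspose (Khat_transpose)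
open Summit.QuantumFields.BalabanUV.Beta.D1BFx.TorusHodgeWeight (Dhat DhatS)
open Summit.QuantumFields.BalabanUV.Beta.D1BFx.TorusCoframeJets (Djet Djet_apply tip Dhat_bond_apply)
open Summit.QuantumFields.BalabanUV.Beta.D1BFx.WardJetsFromNoether (oslot)
open Summit.QuantumFields.BalabanUV.Beta.D1BFx.WardJetsSources (wardSrc₁ wardSrc₂)
open Summit.QuantumFields.BalabanUV.Beta.D1BFx.WardJetsSourcesParity (sandwich_of_letter sandwich_add_transpose_of_antisymm symPart_tip
  symPart_midpoint_eq_zero)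

variable (m : ℕ) (p : ℕ) [NeZero p] (r : Fin (3 + 1) → ℕ)

/-! ## §1 THE CONVENTION's gauge jet is a single-row generator table with the tip weight -/

/-- [folklore] **THE CONVENTION IS SINGLE-ROW (tip read-out)**: `((Ê_b)^·N̂) i a = [e₁ i = b]·N̂[tip b, a]`. -/
theorem Djet_submatrix_mul_Nhat_apply (b : Site 4 ((m + 1) * p) × Fin 4) (i : I 3 (m + 1) p) (a : CombRows (toSite r) (m + 1) p) :
    ((Djet ((m + 1) * p) b).submatrix (e₁ (m + 1) p) id * Nhat r (m + 1) p) i a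
      = if e₁ (m + 1) p i = b then Nhat r (m + 1) p (tip ((m + 1) * p) b) a else 0 := by
  rw [Matrix.mul_apply]
  simp only [Matrix.submatrix_apply, id, Djet_apply]
  by_cases h : e₁ (m + 1) p i = b
  · rw [if_pos h]
    simp only [h, true_and, ite_mul, one_mul, zero_mul, Finset.sum_ite_eq', Finset.mem_univ, if_true]
  · rw [if_neg h]
    exact Finset.sum_eq_zero fun z _ => by rw [if_neg (fun hz => h hz.1), zero_mul]

/-- [folklore] **THE CONVENTION's jet at bond `b` IS PART 1's `x₁ (inl (e₁⁻¹ b))`** for the single-row family with the TIP weight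
`Nt i a = N̂[tip (e₁ i), a]`. -/
theorem conv_eq_x₁ (Nt : I 3 (m + 1) p → CombRows (toSite r) (m + 1) p → ℝ)
    (hNt : ∀ i a, Nt i a = Nhat r (m + 1) p (tip ((m + 1) * p) (e₁ (m + 1) p i)) a)
    (x₁ : I 3 (m + 1) p ⊕ J 3 p → Matrix (I 3 (m + 1) p) (CombRows (toSite r) (m + 1) p) ℝ)
    (hx : ∀ k i a, x₁ k i a = if Sum.inl i = k then Nt i a else 0) (b : Site 4 ((m + 1) * p) × Fin 4) :
    x₁ (Sum.inl ((e₁ (m + 1) p).symm b)) = (Djet ((m + 1) * p) b).submatrix (e₁ (m + 1) p) id * Nhat r (m + 1) p := by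
  ext i a
  rw [hx, Djet_submatrix_mul_Nhat_apply]
  simp only [Sum.inl.injEq]
  by_cases h : e₁ (m + 1) p i = b
  · have hi : i = (e₁ (m + 1) p).symm b := by rw [← h, Equiv.symm_apply_apply]
    rw [if_pos hi, if_pos h, hNt, h]
  · have hi : i ≠ (e₁ (m + 1) p).symm b := fun hi => h (by rw [hi, Equiv.apply_symm_apply])
    rw [if_neg hi, if_neg h]

/-! ## §2 (A1)'s letters on the torus: `aₛ aₜ aₛₜ` with sources, `bₛ bₜ bₛₜ` verbatim -/

/-- [folklore] **«WARD-L WITH SOURCES» ON THE TORUS, ORDER ONE.**  Packed first tables `kkt (K₁ k) (Q₁ k)` over `𝕄₀ = kkt K̂ 𝒬̂`, the comb gauge basis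
`Ŵ₀`, THE CONVENTION's single-row generator tables with the tip weight; the packed Noether jet [P1] in every direction.  Then for every fine torus
bond `b` (the road: `b = (siteOf 4 s 0, μ)` resp. `(siteOf 4 s z, ν)`), with `kb := K₁ (inl (e₁⁻¹ b))`, `qb := Q₁ (inl (e₁⁻¹ b))` and the gauge jet
`Wb := (Ê_b)^·N̂` EXACTLY as (A1) pins it: `kb·Ŵ₀ + K̂·Wb = −(K̂[j, e₁⁻¹ b]·N̂[tip (e₁ j), a])_{j,a}` ((A1)'s `aₛ` WITH SOURCE) and `qb·Ŵ₀ + 𝒬̂·Wb = 0`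
((A1)'s `bₛ` VERBATIM). -/
theorem wardSrc₁_torus
    (K₁ : I 3 (m + 1) p ⊕ J 3 p → Matrix (I 3 (m + 1) p) (I 3 (m + 1) p) ℝ) (Q₁ : I 3 (m + 1) p ⊕ J 3 p → Matrix (J 3 p) (I 3 (m + 1) p) ℝ)
    (Nt : I 3 (m + 1) p → CombRows (toSite r) (m + 1) p → ℝ)
    (hNt : ∀ i a, Nt i a = Nhat r (m + 1) p (tip ((m + 1) * p) (e₁ (m + 1) p i)) a)
    (x₁ : I 3 (m + 1) p ⊕ J 3 p → Matrix (I 3 (m + 1) p) (CombRows (toSite r) (m + 1) p) ℝ)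
    (hx : ∀ k i a, x₁ k i a = if Sum.inl i = k then Nt i a else 0)
    (hP1 : ∀ k, kkt (K₁ k) (Q₁ k) * fromRows (What0 r (m + 1) p) (0 : Matrix (J 3 p) (CombRows (toSite r) (m + 1) p) ℝ)
      + kkt (Khat (d := 3) (m + 1) p) (Qhat (d := 3) (m + 1) p) * fromRows (x₁ k) (0 : Matrix (J 3 p) (CombRows (toSite r) (m + 1) p) ℝ)
      + oslot (fun j => fromRows (x₁ j) (0 : Matrix (J 3 p) (CombRows (toSite r) (m + 1) p) ℝ))
          (fun i => kkt (Khat (d := 3) (m + 1) p) (Qhat (d := 3) (m + 1) p) i k) = 0)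
    (b : Site 4 ((m + 1) * p) × Fin 4) :
    K₁ (Sum.inl ((e₁ (m + 1) p).symm b)) * What0 r (m + 1) p
        + Khat (d := 3) (m + 1) p * ((Djet ((m + 1) * p) b).submatrix (e₁ (m + 1) p) id * Nhat r (m + 1) p)
      = -Matrix.of (fun j a => Khat (d := 3) (m + 1) p j ((e₁ (m + 1) p).symm b) * Nhat r (m + 1) p (tip ((m + 1) * p) (e₁ (m + 1) p j)) a)
    ∧ Q₁ (Sum.inl ((e₁ (m + 1) p).symm b)) * What0 r (m + 1) p
        + Qhat (d := 3) (m + 1) p * ((Djet ((m + 1) * p) b).submatrix (e₁ (m + 1) p) id * Nhat r (m + 1) p) = 0 := by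
  have h := wardSrc₁ (Khat (d := 3) (m + 1) p) (Qhat (d := 3) (m + 1) p) K₁ Q₁ (What0 r (m + 1) p) Nt x₁ hx hP1 ((e₁ (m + 1) p).symm b)
  rw [conv_eq_x₁ m p r Nt hNt x₁ hx b] at h
  refine ⟨h.1.trans ?_, h.2⟩
  congr 1
  ext j a
  rw [Matrix.of_apply, Matrix.of_apply, hNt]

/-- [folklore] **«WARD-L WITH SOURCES» ON THE TORUS, ORDER TWO (mixed).**  In addition packed second tables `𝕄₂` with `𝕄₂ (inl i) (inl i′) = kkt (K₂ i i′) (Q₂ i i′)`,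
THE CONVENTION's second generator tables `X₂ k l = [k = l]•X₁ k`, and the packed second Noether jet [P2].  Then for all torus bonds `b b′`, with
`iₛ := e₁⁻¹ b`, `iₜ := e₁⁻¹ b′`, `Wₛ := (Ê_b)^·N̂`, `Wₜ := (Ê_{b′})^·N̂`, `Wₛₜ := [b = b′]•Wₛ` (as (A1)'s `hWₛₜ` pins it):
`K₂ iₛ iₜ·Ŵ₀ + kₛ·Wₜ + kₜ·Wₛ + K̂·Wₛₜ = −((kₜ[j,iₛ] + [j = iₜ]·K̂[iₜ,iₛ] + [j = iₛ]·K̂[iₛ,iₜ])·N̂[tip (e₁ j), a])_{j,a}` ((A1)'s `aₛₜ` WITH SOURCE) and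
`Q₂ iₛ iₜ·Ŵ₀ + qₛ·Wₜ + qₜ·Wₛ + 𝒬̂·Wₛₜ = 0` ((A1)'s `bₛₜ` VERBATIM). -/
theorem wardSrc₂_torus
    (K₁ : I 3 (m + 1) p ⊕ J 3 p → Matrix (I 3 (m + 1) p) (I 3 (m + 1) p) ℝ) (Q₁ : I 3 (m + 1) p ⊕ J 3 p → Matrix (J 3 p) (I 3 (m + 1) p) ℝ)
    (K₂ : I 3 (m + 1) p → I 3 (m + 1) p → Matrix (I 3 (m + 1) p) (I 3 (m + 1) p) ℝ)
    (Q₂ : I 3 (m + 1) p → I 3 (m + 1) p → Matrix (J 3 p) (I 3 (m + 1) p) ℝ)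
    (Nt : I 3 (m + 1) p → CombRows (toSite r) (m + 1) p → ℝ)
    (hNt : ∀ i a, Nt i a = Nhat r (m + 1) p (tip ((m + 1) * p) (e₁ (m + 1) p i)) a)
    (x₁ : I 3 (m + 1) p ⊕ J 3 p → Matrix (I 3 (m + 1) p) (CombRows (toSite r) (m + 1) p) ℝ)
    (hx : ∀ k i a, x₁ k i a = if Sum.inl i = k then Nt i a else 0)
    (𝕄₂ : I 3 (m + 1) p ⊕ J 3 p → I 3 (m + 1) p ⊕ J 3 p → Matrix (I 3 (m + 1) p ⊕ J 3 p) (I 3 (m + 1) p ⊕ J 3 p) ℝ)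
    (h𝕄₂ : ∀ i i' : I 3 (m + 1) p, 𝕄₂ (Sum.inl i) (Sum.inl i') = kkt (K₂ i i') (Q₂ i i'))
    (X₂ : I 3 (m + 1) p ⊕ J 3 p → I 3 (m + 1) p ⊕ J 3 p → Matrix (I 3 (m + 1) p ⊕ J 3 p) (CombRows (toSite r) (m + 1) p) ℝ)
    (hX₂ : ∀ k l, X₂ k l = if k = l then fromRows (x₁ k) (0 : Matrix (J 3 p) (CombRows (toSite r) (m + 1) p) ℝ) else 0)
    (hP2 : ∀ k l, 𝕄₂ k l * fromRows (What0 r (m + 1) p) (0 : Matrix (J 3 p) (CombRows (toSite r) (m + 1) p) ℝ)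
      + kkt (K₁ k) (Q₁ k) * fromRows (x₁ l) (0 : Matrix (J 3 p) (CombRows (toSite r) (m + 1) p) ℝ)
      + kkt (K₁ l) (Q₁ l) * fromRows (x₁ k) (0 : Matrix (J 3 p) (CombRows (toSite r) (m + 1) p) ℝ)
      + kkt (Khat (d := 3) (m + 1) p) (Qhat (d := 3) (m + 1) p) * X₂ k l
      + oslot (fun j => fromRows (x₁ j) (0 : Matrix (J 3 p) (CombRows (toSite r) (m + 1) p) ℝ)) (fun i => kkt (K₁ l) (Q₁ l) i k)
      + oslot (X₂ l) (fun i => kkt (Khat (d := 3) (m + 1) p) (Qhat (d := 3) (m + 1) p) i k)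
      + oslot (X₂ k) (fun i => kkt (Khat (d := 3) (m + 1) p) (Qhat (d := 3) (m + 1) p) i l) = 0)
    (b b' : Site 4 ((m + 1) * p) × Fin 4) :
    K₂ ((e₁ (m + 1) p).symm b) ((e₁ (m + 1) p).symm b') * What0 r (m + 1) p
        + K₁ (Sum.inl ((e₁ (m + 1) p).symm b)) * ((Djet ((m + 1) * p) b').submatrix (e₁ (m + 1) p) id * Nhat r (m + 1) p)
        + K₁ (Sum.inl ((e₁ (m + 1) p).symm b')) * ((Djet ((m + 1) * p) b).submatrix (e₁ (m + 1) p) id * Nhat r (m + 1) p)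
        + Khat (d := 3) (m + 1) p * (if b = b' then (Djet ((m + 1) * p) b).submatrix (e₁ (m + 1) p) id * Nhat r (m + 1) p else 0)
      = -Matrix.of (fun j a => (K₁ (Sum.inl ((e₁ (m + 1) p).symm b')) j ((e₁ (m + 1) p).symm b)
          + (if j = (e₁ (m + 1) p).symm b' then Khat (d := 3) (m + 1) p ((e₁ (m + 1) p).symm b') ((e₁ (m + 1) p).symm b) else 0)
          + (if j = (e₁ (m + 1) p).symm b then Khat (d := 3) (m + 1) p ((e₁ (m + 1) p).symm b) ((e₁ (m + 1) p).symm b') else 0))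
          * Nhat r (m + 1) p (tip ((m + 1) * p) (e₁ (m + 1) p j)) a)
    ∧ Q₂ ((e₁ (m + 1) p).symm b) ((e₁ (m + 1) p).symm b') * What0 r (m + 1) p
        + Q₁ (Sum.inl ((e₁ (m + 1) p).symm b)) * ((Djet ((m + 1) * p) b').submatrix (e₁ (m + 1) p) id * Nhat r (m + 1) p)
        + Q₁ (Sum.inl ((e₁ (m + 1) p).symm b')) * ((Djet ((m + 1) * p) b).submatrix (e₁ (m + 1) p) id * Nhat r (m + 1) p)
        + Qhat (d := 3) (m + 1) p * (if b = b' then (Djet ((m + 1) * p) b).submatrix (e₁ (m + 1) p) id * Nhat r (m + 1) p else 0) = 0 := by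
  have h := wardSrc₂ (Khat (d := 3) (m + 1) p) (Qhat (d := 3) (m + 1) p) K₁ Q₁ K₂ Q₂ (What0 r (m + 1) p) Nt x₁ hx 𝕄₂ h𝕄₂ X₂ hX₂ hP2
    ((e₁ (m + 1) p).symm b) ((e₁ (m + 1) p).symm b')
  have hst : ((e₁ (m + 1) p).symm b = (e₁ (m + 1) p).symm b') = (b = b') := propext (e₁ (m + 1) p).symm.injective.eq_iff
  rw [conv_eq_x₁ m p r Nt hNt x₁ hx b, conv_eq_x₁ m p r Nt hNt x₁ hx b'] at h
  simp only [hst] at h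
  refine ⟨h.1.trans ?_, h.2⟩
  congr 1
  ext j a
  rw [Matrix.of_apply, Matrix.of_apply, hNt]

/-! ## §3 The torus parity constraint (Q-WL-2 on the road's objects) -/

/-- [folklore] **`D̂ₛ` IN CLOSED FORM**: `DhatS m p j z = [z = tip (e₁ j)] − [z = (e₁ j).1]` (`TorusCoframeJets.Dhat_bond_apply` re-indexed). -/
theorem DhatS_apply_eq (j : I 3 (m + 1) p) (z : Site 4 ((m + 1) * p)) :
    DhatS m p j z = (if z = tip ((m + 1) * p) (e₁ (m + 1) p j) then (1 : ℝ) else 0) - (if z = (e₁ (m + 1) p j).1 then 1 else 0) := by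
  rw [DhatS, Matrix.submatrix_apply, Dhat_bond_apply]
  rfl

variable {m r} in
/-- [folklore] **Q-WL-2 ON THE ROAD's TORI (tip read-out): THE HADAMARD CONSTRAINT.**  If `K̂` kills the FULL fine gradient (`K̂·D̂ₛ = 0`, displayed),
and an ANTISYMMETRIC table `kb` satisfies the order-one letter WITH SOURCE of §2 at the torus bond `b` (for some gauge jet `Wb`), then for all comb
bonds `a a′`: `Σ_j K̂[j, e₁⁻¹ b]·Ŵ₀[j,a]·Ŵ₀[j,a′] = 0`.  (The toy T-d1leaf03g13-WARDL: this fails for `d*d` on the 4×4 torus — `5∕4`; whether it fails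
on the road's 4D tori is a computation, not decided here.) -/
theorem hadamard_of_tip_antisymm_torus (hr : r ∈ box (3 + 1) (m + 1)) (hKD : Khat (d := 3) (m + 1) p * DhatS m p = 0)
    (b : Site 4 ((m + 1) * p) × Fin 4) (kb : Matrix (I 3 (m + 1) p) (I 3 (m + 1) p) ℝ) (hkb : kbᵀ = -kb)
    (Wb : Matrix (I 3 (m + 1) p) (CombRows (toSite r) (m + 1) p) ℝ)
    (h : kb * What0 r (m + 1) p + Khat (d := 3) (m + 1) p * Wb
      = -Matrix.of (fun j a => Khat (d := 3) (m + 1) p j ((e₁ (m + 1) p).symm b) * Nhat r (m + 1) p (tip ((m + 1) * p) (e₁ (m + 1) p j)) a))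
    (a a' : CombRows (toSite r) (m + 1) p) :
    ∑ j, Khat (d := 3) (m + 1) p j ((e₁ (m + 1) p).symm b) * (What0 r (m + 1) p j a * What0 r (m + 1) p j a') = 0 := by
  rw [What0_eq_DhatS_mul_Nhat r m p hr] at h ⊢
  exact WardJetsSourcesParity.hadamard_of_tip_antisymm (Khat (d := 3) (m + 1) p) kb (DhatS m p) (Nhat r (m + 1) p)
    (fun j => tip ((m + 1) * p) (e₁ (m + 1) p j)) (fun j => (e₁ (m + 1) p j).1) (DhatS_apply_eq m p)
    (fun j a => Nhat r (m + 1) p (tip ((m + 1) * p) (e₁ (m + 1) p j)) a) (fun _ _ => rfl) (Khat_transpose (m + 1) p) hKD hkb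
    ((e₁ (m + 1) p).symm b) Wb h a a'

variable {m r} in
/-- [folklore] **THE MIDPOINT READ-OUT CARRIES NO PARITY CONSTRAINT ON THE TORUS**: with the midpoint weight `Nt j a = ½(N̂[tip (e₁ j), a] + N̂[(e₁ j).1, a])`
and `K̂·D̂ₛ = 0`, the symmetric part of the source sandwich `Ŵ₀ᵀ·(K̂[j,i]·Nt[j,a])` vanishes identically (PART 1b `symPart_midpoint_eq_zero`). -/
theorem symPart_midpoint_torus_eq_zero (hr : r ∈ box (3 + 1) (m + 1)) (hKD : Khat (d := 3) (m + 1) p * DhatS m p = 0)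
    (Nt : I 3 (m + 1) p → CombRows (toSite r) (m + 1) p → ℝ)
    (hNt : ∀ j a, Nt j a = (Nhat r (m + 1) p (tip ((m + 1) * p) (e₁ (m + 1) p j)) a + Nhat r (m + 1) p (e₁ (m + 1) p j).1 a) / 2)
    (i : I 3 (m + 1) p) :
    (What0 r (m + 1) p)ᵀ * Matrix.of (fun j a => Khat (d := 3) (m + 1) p j i * Nt j a)
      + ((What0 r (m + 1) p)ᵀ * Matrix.of (fun j a => Khat (d := 3) (m + 1) p j i * Nt j a))ᵀ = 0 := by
  rw [What0_eq_DhatS_mul_Nhat r m p hr]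
  exact symPart_midpoint_eq_zero (Khat (d := 3) (m + 1) p) (DhatS m p) (Nhat r (m + 1) p) (fun j => tip ((m + 1) * p) (e₁ (m + 1) p j))
    (fun j => (e₁ (m + 1) p j).1) (DhatS_apply_eq m p) Nt hNt (Khat_transpose (m + 1) p) hKD i

end Summit.QuantumFields.BalabanUV.Beta.D1BFx.WardJetsSourcesTorus

end
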